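import Summits.QuantumFields.YangMills.Theorems.PoincareLipschitzLeungXinSphereIdentity
import Literature.MathematicalPhysics.QuantumFieldTheory.Balaban1983to89.MatrixNorms

/-!
# Crux `HistoryTailL` (stmt-QuantumFields-19936), K2 organ of record «LOC-REG-MIN» (`hReg`, route crux `PoincareLipschitz.BlockLipschitzL`,
# stmt-QuantumFields-23533): THE `SU(2) → S³ ⊂ ℝ⁴` DICTIONARY — the box-ℓ² orbit energy of two `SU(2)` fields IS the twisted discrete
# Dirichlet energy of a map into the three-sphere, in the letters of ✓`PoincareLipschitzLeungXinSphereIdentity` (`Fin 4 → ℝ`, `⬝ᵥ`)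

Cell `ym3-torus` (YM ladder rung R3 = continuum SU(2) Yang–Mills on the three-torus — a RUNG, NOT the Clay problem: not d = 4, not infinite
volume, not a mass gap), LEAD seat `ym-ust-19936-w1` gen 8; `--supports stmt-QuantumFields-19936 --as helper`; THEOREMS ONLY, definition-free
(the coordinate vector of `U ∈ SU(2)` is the TERM `![(U 0 0).re, (U 0 0).im, (U 1 0).re, (U 1 0).im]`, written out every time).

WHY.  The K2 face of record (LEAD rulings 2026-08-29T04:20Z/04:38Z; ★w2-19936 g11's frozen `hReg`, filed as `…ChartsOfOrbitMinRegularity`) is the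
Schoen–Uhlenbeck ∕ Leung–Xin law for box-ℓ²-orbit MINIMISERS `h` of `Σ_b dist1(V_b·(h_x W_b h_y⁻¹)⁻¹)²`.  The stability letters
(✓`…LeungXinSphereIdentity`, ✓/⧗`…LeungXinGraphStability`, ★w8-19936 g6's twisted identity) speak about unit vectors of `ℝ⁴` and bond correlations
`p·q`.  THIS FILE is the bridge: for `g, h ∈ SU(2)`, with `v(U) := (Re U₀₀, Im U₀₀, Re U₁₀, Im U₁₀)`,
* `v(g)` is a unit vector, and `reTr(g⁻¹h) = v(g)·v(h)` (`reTr` = the tree's normalised real trace `UnitaryModel.nReTr`, `Re Tr/2`);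
* `dist1(g·h⁻¹)² = |v(g) − v(h)|² = 2 − 2·v(g)·v(h)` (the tree's `dist1` = operator-norm distance; on `SU(2)` it is the chordal distance of `S³`,
  ✓`MatrixNorms.opDist1_sq_eq_of_mem_specialUnitaryGroup_two`);
* the BOND TERM of the orbit energy: `dist1(V_b·(h_x W_b h_y⁻¹)⁻¹)² = 2 − 2·v(h_x)·v(V_b h_y W_b⁻¹)` — a twisted Dirichlet bond energy into `S³`;
* every unit vector of `ℝ⁴` is `v(g)` for some `g ∈ SU(2)` (so the Leung–Xin varied unit vectors ARE gauge transformations);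
* the twist `g ↦ V g W` acts on `v` by an ORTHOGONAL `4×4` matrix (`∃ R, Rᵀ R = 1 ∧ R Rᵀ = 1 ∧ ∀ g, v(VgW) = R *ᵥ v(g)`) — ★w8's `R_b`.

WHAT (ns `…Theorems.PoincareLipschitzSU2SphereDictionary`).
* §1 `su2_apply_one_one`, `su2_apply_zero_one`, `su2_normSq_add_normSq` (the `!![a, -b̄; b, ā]` shape; adapted from the programme's
  `Summits/Ventures/LatticeQCDFlow/Scaling/SU2Sphere.lean`, which is not importable here), `coords_dot_self`.
* §2 ★ `coords_dot_coords_eq_nReTr` (`v(U)·v(V) = nReTr(Uᴴ V)`), ★ `reTr_inv_mul_eq_dot`, ★★ `dist1_mul_inv_sq_eq` (`dist1(g h⁻¹)² = 2 − 2v(g)·v(h)`),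
  ★★ `dist1_bond_sq_eq` (the orbit-energy bond term).
* §3 ★ `exists_su2_coords_eq` (surjectivity onto `S³`).
* §4 ★★ `exists_orthogonal_twist` (the twist is orthogonal on `ℝ⁴`, with the defect bound `‖R − 1‖_F² ≤ 8(dist1 V² + dist1 W²)`).
HONEST SCOPE.  Linear algebra of `2×2` special unitary matrices; nothing of LOC-REG-MIN (`hReg`), `BlockLipschitzL`, `HistoryTailL` or any summit statement
is proved.  YM₃ on T³ is rung R3, NOT the Clay problem.

References: T. Bałaban, Commun. Math. Phys. **109** (1987) 249–301 [Balaban1987RG1] ((0.14) p.254: `|U − 1|² = 2(1 − Re tr U)`); Y. L. Xin, Duke Math. J.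
**47** (1980) 609–613 [Xin1980].
-/

set_option autoImplicit false

noncomputable section

open scoped BigOperators ComplexConjugate Matrix.Norms.L2Operator
open Matrix

namespace Summit.QuantumFields.YangMills.Theorems.PoincareLipschitzSU2SphereDictionary

open Literature.MathematicalPhysics.QuantumFieldTheory.Balaban1983to89

/-! ## §1 The shape of an `SU(2)` matrix and the unit coordinate vector -/

section Shape

variable (U : Matrix.specialUnitaryGroup (Fin 2) ℂ)

/-- `U U† = 1`. [folklore] -/
theorem mul_star_self : (U : Matrix (Fin 2) (Fin 2) ℂ) * star (U : Matrix (Fin 2) (Fin 2) ℂ) = 1 :=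
  Matrix.mem_unitaryGroup_iff.mp (Matrix.specialUnitaryGroup_le_unitaryGroup U.2)

/-- `U† U = 1`. [folklore] -/
theorem star_mul_self : star (U : Matrix (Fin 2) (Fin 2) ℂ) * (U : Matrix (Fin 2) (Fin 2) ℂ) = 1 :=
  Matrix.mem_unitaryGroup_iff'.mp (Matrix.specialUnitaryGroup_le_unitaryGroup U.2)

/-- For `U ∈ SU(2)` the adjoint is the adjugate. [folklore] -/
theorem star_eq_adjugate : star (U : Matrix (Fin 2) (Fin 2) ℂ) = adjugate (U : Matrix (Fin 2) (Fin 2) ℂ) := by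
  have h1 := mul_star_self U
  have h2 : (U : Matrix (Fin 2) (Fin 2) ℂ) * adjugate (U : Matrix (Fin 2) (Fin 2) ℂ) = 1 := by
    rw [Matrix.mul_adjugate, (Matrix.mem_specialUnitaryGroup_iff.mp U.2).2, one_smul]
  rw [← Matrix.inv_eq_right_inv h1, Matrix.inv_eq_right_inv h2]

/-- `U₁₁ = conj U₀₀` for `U ∈ SU(2)`. [folklore] -/
theorem su2_apply_one_one : (U : Matrix (Fin 2) (Fin 2) ℂ) 1 1 = conj ((U : Matrix (Fin 2) (Fin 2) ℂ) 0 0) := by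
  have h := congrFun (congrFun (star_eq_adjugate U) 0) 0
  rw [Matrix.adjugate_fin_two, Matrix.star_apply] at h
  simpa using h.symm

/-- `U₀₁ = −conj U₁₀` for `U ∈ SU(2)`. [folklore] -/
theorem su2_apply_zero_one : (U : Matrix (Fin 2) (Fin 2) ℂ) 0 1 = -conj ((U : Matrix (Fin 2) (Fin 2) ℂ) 1 0) := by
  have h := congrFun (congrFun (star_eq_adjugate U) 1) 0
  rw [Matrix.adjugate_fin_two, Matrix.star_apply] at h
  have h' : conj ((U : Matrix (Fin 2) (Fin 2) ℂ) 0 1) = -(U : Matrix (Fin 2) (Fin 2) ℂ) 1 0 := by simpa using h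
  have h'' := congrArg conj h'
  simpa using h''

/-- The first column of `U ∈ SU(2)` is a unit vector of `ℂ²`: `|U₀₀|² + |U₁₀|² = 1`. [folklore] -/
theorem su2_normSq_add_normSq :
    Complex.normSq ((U : Matrix (Fin 2) (Fin 2) ℂ) 0 0) + Complex.normSq ((U : Matrix (Fin 2) (Fin 2) ℂ) 1 0) = 1 := by
  have h := congrFun (congrFun (star_mul_self U) 0) 0
  rw [Matrix.mul_apply, Fin.sum_univ_two, Matrix.star_apply, Matrix.star_apply, Matrix.one_apply_eq] at h
  have h' : ((Complex.normSq ((U : Matrix (Fin 2) (Fin 2) ℂ) 0 0) : ℂ) + (Complex.normSq ((U : Matrix (Fin 2) (Fin 2) ℂ) 1 0) : ℂ)) = 1 := by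
    rw [Complex.normSq_eq_conj_mul_self, Complex.normSq_eq_conj_mul_self]
    simpa using h
  exact_mod_cast h'

/-- **`v(U)` IS A UNIT VECTOR OF `ℝ⁴`** (`v(U) = (Re U₀₀, Im U₀₀, Re U₁₀, Im U₁₀)`). [folklore] -/
theorem coords_dot_self :
    dotProduct ![((U : Matrix (Fin 2) (Fin 2) ℂ) 0 0).re, ((U : Matrix (Fin 2) (Fin 2) ℂ) 0 0).im,
        ((U : Matrix (Fin 2) (Fin 2) ℂ) 1 0).re, ((U : Matrix (Fin 2) (Fin 2) ℂ) 1 0).im]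
      ![((U : Matrix (Fin 2) (Fin 2) ℂ) 0 0).re, ((U : Matrix (Fin 2) (Fin 2) ℂ) 0 0).im,
        ((U : Matrix (Fin 2) (Fin 2) ℂ) 1 0).re, ((U : Matrix (Fin 2) (Fin 2) ℂ) 1 0).im] = 1 := by
  have h := su2_normSq_add_normSq U
  rw [Complex.normSq_apply, Complex.normSq_apply] at h
  simp [dotProduct, Fin.sum_univ_four]
  nlinarith [h]

end Shape

/-! ## §2 Traces and distances are dot products -/

section Trace

variable (U V : Matrix.specialUnitaryGroup (Fin 2) ℂ)

/-- ★ **`v(U)·v(V) = Re Tr(U† V)/2 = nReTr(U† V)`** for `U, V ∈ SU(2)`. [cite: Balaban1987RG1, (0.14) p.254; folklore quaternion algebra] -/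
theorem coords_dot_coords_eq_nReTr :
    dotProduct ![((U : Matrix (Fin 2) (Fin 2) ℂ) 0 0).re, ((U : Matrix (Fin 2) (Fin 2) ℂ) 0 0).im,
        ((U : Matrix (Fin 2) (Fin 2) ℂ) 1 0).re, ((U : Matrix (Fin 2) (Fin 2) ℂ) 1 0).im]
      ![((V : Matrix (Fin 2) (Fin 2) ℂ) 0 0).re, ((V : Matrix (Fin 2) (Fin 2) ℂ) 0 0).im,
        ((V : Matrix (Fin 2) (Fin 2) ℂ) 1 0).re, ((V : Matrix (Fin 2) (Fin 2) ℂ) 1 0).im] =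
      UnitaryModel.nReTr (star (U : Matrix (Fin 2) (Fin 2) ℂ) * (V : Matrix (Fin 2) (Fin 2) ℂ)) := by
  have hU11 := su2_apply_one_one U
  have hU01 := su2_apply_zero_one U
  have hV11 := su2_apply_one_one V
  have hV01 := su2_apply_zero_one V
  rw [UnitaryModel.nReTr, Matrix.trace_fin_two, Matrix.mul_apply, Matrix.mul_apply, Fin.sum_univ_two, Fin.sum_univ_two]
  simp only [Matrix.star_apply, Fintype.card_fin, Nat.cast_ofNat, RCLike.star_def]
  rw [hU11, hU01, hV11, hV01]
  simp [dotProduct, Fin.sum_univ_four, Complex.add_re, Complex.mul_re, Complex.conj_re, Complex.conj_im]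
  ring

/-- ★ **`reTr(U⁻¹ V) = v(U)·v(V)`** in the gauge-group interface of the tree (`reTr` on `SU(2)` is `UnitaryModel.nReTr` of the matrix, by `rfl`).
[cite: Balaban1987RG1, (0.2) and (0.14) p.252–254] -/
theorem reTr_inv_mul_eq_dot :
    GaugeGroup.reTr (U⁻¹ * V) =
      dotProduct ![((U : Matrix (Fin 2) (Fin 2) ℂ) 0 0).re, ((U : Matrix (Fin 2) (Fin 2) ℂ) 0 0).im,
          ((U : Matrix (Fin 2) (Fin 2) ℂ) 1 0).re, ((U : Matrix (Fin 2) (Fin 2) ℂ) 1 0).im]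
        ![((V : Matrix (Fin 2) (Fin 2) ℂ) 0 0).re, ((V : Matrix (Fin 2) (Fin 2) ℂ) 0 0).im,
          ((V : Matrix (Fin 2) (Fin 2) ℂ) 1 0).re, ((V : Matrix (Fin 2) (Fin 2) ℂ) 1 0).im] := by
  rw [coords_dot_coords_eq_nReTr]
  rfl

/-- ★★ **`dist1(U V⁻¹)² = 2 − 2·v(U)·v(V) = |v(U) − v(V)|²`**: the tree's operator-norm distance on `SU(2)` is the chordal distance of `S³`.
(`dist1(W)² = 2(1 − reTr W)` on `SU(2)`, ✓`MatrixNorms.opDist1_sq_eq_of_mem_specialUnitaryGroup_two`, at `W = U V⁻¹`, and `reTr(UV⁻¹) = reTr(V⁻¹U)`.)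
[cite: Balaban1987RG1, (0.14) p.254] -/
theorem dist1_mul_inv_sq_eq :
    GaugeGroup.dist1 (U * V⁻¹) ^ 2 =
      2 - 2 * dotProduct ![((U : Matrix (Fin 2) (Fin 2) ℂ) 0 0).re, ((U : Matrix (Fin 2) (Fin 2) ℂ) 0 0).im,
          ((U : Matrix (Fin 2) (Fin 2) ℂ) 1 0).re, ((U : Matrix (Fin 2) (Fin 2) ℂ) 1 0).im]
        ![((V : Matrix (Fin 2) (Fin 2) ℂ) 0 0).re, ((V : Matrix (Fin 2) (Fin 2) ℂ) 0 0).im,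
          ((V : Matrix (Fin 2) (Fin 2) ℂ) 1 0).re, ((V : Matrix (Fin 2) (Fin 2) ℂ) 1 0).im] := by
  have hsq : GaugeGroup.dist1 (U * V⁻¹) ^ 2 = 2 * (1 - GaugeGroup.reTr (U * V⁻¹)) :=
    MatrixNorms.opDist1_sq_eq_of_mem_specialUnitaryGroup_two (U * V⁻¹).2
  have hconj : GaugeGroup.reTr (U * V⁻¹) = GaugeGroup.reTr (V⁻¹ * U) := by
    have h := GaugeGroup.reTr_conj (V⁻¹ * U) V
    rw [← mul_assoc, mul_inv_cancel, one_mul] at h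
    exact h
  rw [hsq, hconj, reTr_inv_mul_eq_dot V U, dotProduct_comm]
  ring

/-- The same in the `|v(U) − v(V)|²` form. [cite: Balaban1987RG1, (0.14) p.254] -/
theorem dist1_mul_inv_sq_eq_dot_sub :
    GaugeGroup.dist1 (U * V⁻¹) ^ 2 =
      dotProduct
        (![((U : Matrix (Fin 2) (Fin 2) ℂ) 0 0).re, ((U : Matrix (Fin 2) (Fin 2) ℂ) 0 0).im,
            ((U : Matrix (Fin 2) (Fin 2) ℂ) 1 0).re, ((U : Matrix (Fin 2) (Fin 2) ℂ) 1 0).im] -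
          ![((V : Matrix (Fin 2) (Fin 2) ℂ) 0 0).re, ((V : Matrix (Fin 2) (Fin 2) ℂ) 0 0).im,
            ((V : Matrix (Fin 2) (Fin 2) ℂ) 1 0).re, ((V : Matrix (Fin 2) (Fin 2) ℂ) 1 0).im])
        (![((U : Matrix (Fin 2) (Fin 2) ℂ) 0 0).re, ((U : Matrix (Fin 2) (Fin 2) ℂ) 0 0).im,
            ((U : Matrix (Fin 2) (Fin 2) ℂ) 1 0).re, ((U : Matrix (Fin 2) (Fin 2) ℂ) 1 0).im] -
          ![((V : Matrix (Fin 2) (Fin 2) ℂ) 0 0).re, ((V : Matrix (Fin 2) (Fin 2) ℂ) 0 0).im,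
            ((V : Matrix (Fin 2) (Fin 2) ℂ) 1 0).re, ((V : Matrix (Fin 2) (Fin 2) ℂ) 1 0).im]) := by
  rw [dist1_mul_inv_sq_eq, sub_dotProduct, dotProduct_sub, dotProduct_sub, coords_dot_self U, coords_dot_self V, dotProduct_comm]
  ring

end Trace

/-! ## §2b The bond term of the box-ℓ² orbit energy -/

section Bond

variable {P : Params} {i : ℕ}

/-- ★★ **THE ORBIT-ENERGY BOND TERM IS A TWISTED DIRICHLET BOND ENERGY INTO `S³`**: for level-`i` fields `V, W`, a gauge transformation `h` and a bond `b`,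
`dist1(V_b·(h·W)_b⁻¹)² = 2 − 2·v(h(b₋))·v(V_b·h(b₊)·W_b⁻¹)` (`(h·W)_b = h(b₋) W_b h(b₊)⁻¹`; `reTr` cyclic).  Summed over a box this is the energy whose
minimisers `hReg` speaks about; the Leung–Xin letters apply with `p_b := v(h(b₋))`, `q_b := v(V_b h(b₊) W_b⁻¹)`. [cite: Balaban1987RG1, (0.14) p.254] -/
theorem dist1_bond_sq_eq (V W : GaugeField P i (Matrix.specialUnitaryGroup (Fin 2) ℂ))
    (h : GaugeTransf P i (Matrix.specialUnitaryGroup (Fin 2) ℂ)) (b : PBond P i) :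
    GaugeGroup.dist1 (V b * (GaugeField.gaugeAct h W b)⁻¹) ^ 2 =
      2 - 2 * dotProduct
        ![(((h b.src : Matrix.specialUnitaryGroup (Fin 2) ℂ) : Matrix (Fin 2) (Fin 2) ℂ) 0 0).re,
          (((h b.src : Matrix.specialUnitaryGroup (Fin 2) ℂ) : Matrix (Fin 2) (Fin 2) ℂ) 0 0).im,
          (((h b.src : Matrix.specialUnitaryGroup (Fin 2) ℂ) : Matrix (Fin 2) (Fin 2) ℂ) 1 0).re,
          (((h b.src : Matrix.specialUnitaryGroup (Fin 2) ℂ) : Matrix (Fin 2) (Fin 2) ℂ) 1 0).im]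
        ![(((V b * h b.tgt * (W b)⁻¹ : Matrix.specialUnitaryGroup (Fin 2) ℂ) : Matrix (Fin 2) (Fin 2) ℂ) 0 0).re,
          (((V b * h b.tgt * (W b)⁻¹ : Matrix.specialUnitaryGroup (Fin 2) ℂ) : Matrix (Fin 2) (Fin 2) ℂ) 0 0).im,
          (((V b * h b.tgt * (W b)⁻¹ : Matrix.specialUnitaryGroup (Fin 2) ℂ) : Matrix (Fin 2) (Fin 2) ℂ) 1 0).re,
          (((V b * h b.tgt * (W b)⁻¹ : Matrix.specialUnitaryGroup (Fin 2) ℂ) : Matrix (Fin 2) (Fin 2) ℂ) 1 0).im] := by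
  have hgauge : GaugeField.gaugeAct h W b = h b.src * W b * (h b.tgt)⁻¹ := rfl
  have hX : V b * (GaugeField.gaugeAct h W b)⁻¹ = (h b.src * (V b * h b.tgt * (W b)⁻¹)⁻¹)⁻¹ := by
    rw [hgauge]; group
  rw [hX, GaugeGroup.dist1_inv]
  exact dist1_mul_inv_sq_eq _ _

end Bond

/-! ## §3 Every point of the three-sphere is an `SU(2)` element -/

/-- ★ **SURJECTIVITY**: every unit vector `p ∈ ℝ⁴` is `v(g)` for some `g ∈ SU(2)` (`g = !![a, -b̄; b, ā]`, `a = p₀ + ip₁`, `b = p₂ + ip₃`).  So the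
Leung–Xin varied unit vectors of ✓`…LeungXinGraphStability` are values of gauge transformations. [folklore] -/
theorem exists_su2_coords_eq (p : Fin 4 → ℝ) (hp : dotProduct p p = 1) :
    ∃ g : Matrix.specialUnitaryGroup (Fin 2) ℂ,
      ![((g : Matrix (Fin 2) (Fin 2) ℂ) 0 0).re, ((g : Matrix (Fin 2) (Fin 2) ℂ) 0 0).im,
        ((g : Matrix (Fin 2) (Fin 2) ℂ) 1 0).re, ((g : Matrix (Fin 2) (Fin 2) ℂ) 1 0).im] = p := by
  set a : ℂ := ⟨p 0, p 1⟩ with ha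
  set b : ℂ := ⟨p 2, p 3⟩ with hb
  have hp' : p 0 ^ 2 + p 1 ^ 2 + p 2 ^ 2 + p 3 ^ 2 = 1 := by
    have h := hp
    simp only [dotProduct, Fin.sum_univ_four] at h
    nlinarith [h]
  have hab : Complex.normSq a + Complex.normSq b = 1 := by
    rw [ha, hb, Complex.normSq_mk, Complex.normSq_mk]
    nlinarith [hp']
  have key : a * conj a + b * conj b = 1 := by
    rw [Complex.mul_conj, Complex.mul_conj]
    exact_mod_cast hab
  have hmem : !![a, -conj b; b, conj a] ∈ Matrix.specialUnitaryGroup (Fin 2) ℂ := by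
    refine Matrix.mem_specialUnitaryGroup_iff.mpr ⟨?_, ?_⟩
    · rw [Matrix.mem_unitaryGroup_iff]
      ext i j
      fin_cases i <;> fin_cases j <;> simp [Matrix.mul_apply, Fin.sum_univ_two] <;>
        first | linear_combination key | ring
    · rw [Matrix.det_fin_two_of]
      linear_combination key
  refine ⟨⟨_, hmem⟩, ?_⟩
  ext i
  fin_cases i <;> simp [ha, hb]

/-! ## §4 The twist `g ↦ V g W` is orthogonal on `ℝ⁴` -/

/-- The coordinate map is additive and real-homogeneous on matrices (it reads four real coordinates of two entries). [folklore] -/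
theorem coords_linear (X Y : Matrix (Fin 2) (Fin 2) ℂ) (s t : ℝ) :
    ![((s • X + t • Y) 0 0).re, ((s • X + t • Y) 0 0).im, ((s • X + t • Y) 1 0).re, ((s • X + t • Y) 1 0).im] =
      s • ![(X 0 0).re, (X 0 0).im, (X 1 0).re, (X 1 0).im] + t • ![(Y 0 0).re, (Y 0 0).im, (Y 1 0).re, (Y 1 0).im] := by
  ext i
  fin_cases i <;> simp [Matrix.add_apply, Matrix.smul_apply, Complex.real_smul]

/-- **An `SU(2)` matrix is the real combination of the four unit quaternions with its coordinates**:
`U = p₀·1 + p₁·I + p₂·J + p₃·K` with `1 = !![1,0;0,1]`, `I = !![i,0;0,−i]`, `J = !![0,−1;1,0]`, `K = !![0,i;i,0]` and `p = v(U)`. [folklore] -/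
theorem su2_eq_quaternion_combination (U : Matrix.specialUnitaryGroup (Fin 2) ℂ) :
    (U : Matrix (Fin 2) (Fin 2) ℂ) =
      (((U : Matrix (Fin 2) (Fin 2) ℂ) 0 0).re : ℂ) • (1 : Matrix (Fin 2) (Fin 2) ℂ) +
        (((U : Matrix (Fin 2) (Fin 2) ℂ) 0 0).im : ℂ) • !![Complex.I, 0; 0, -Complex.I] +
        (((U : Matrix (Fin 2) (Fin 2) ℂ) 1 0).re : ℂ) • !![(0 : ℂ), -1; 1, 0] +
        (((U : Matrix (Fin 2) (Fin 2) ℂ) 1 0).im : ℂ) • !![(0 : ℂ), Complex.I; Complex.I, 0] := by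
  have h11 := su2_apply_one_one U
  have h01 := su2_apply_zero_one U
  ext i j
  fin_cases i <;> fin_cases j
  · simp [Matrix.add_apply, Matrix.smul_apply]
    try exact (Complex.re_add_im _).symm
  · simp [Matrix.add_apply, Matrix.smul_apply, h01]
    try (apply Complex.ext <;> simp)
  · simp [Matrix.add_apply, Matrix.smul_apply]
    try exact (Complex.re_add_im _).symm
  · simp [Matrix.add_apply, Matrix.smul_apply, h11]
    try (apply Complex.ext <;> simp)


/-- The four unit quaternions are special unitary: `1`, `I = !![i,0;0,−i]`, `J = !![0,−1;1,0]`, `K = !![0,i;i,0]`. [folklore] -/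
theorem quaternion_units_mem :
    (!![Complex.I, 0; 0, -Complex.I] : Matrix (Fin 2) (Fin 2) ℂ) ∈ Matrix.specialUnitaryGroup (Fin 2) ℂ ∧
      (!![(0 : ℂ), -1; 1, 0] : Matrix (Fin 2) (Fin 2) ℂ) ∈ Matrix.specialUnitaryGroup (Fin 2) ℂ ∧
      (!![(0 : ℂ), Complex.I; Complex.I, 0] : Matrix (Fin 2) (Fin 2) ℂ) ∈ Matrix.specialUnitaryGroup (Fin 2) ℂ := by
  refine ⟨?_, ?_, ?_⟩ <;> refine Matrix.mem_specialUnitaryGroup_iff.mpr ⟨?_, ?_⟩ <;>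
    first
    | (rw [Matrix.mem_unitaryGroup_iff]; ext i j; fin_cases i <;> fin_cases j <;> simp [Matrix.mul_apply, Fin.sum_univ_two])
    | (rw [Matrix.det_fin_two_of]; simp)

/-- The coordinate map on a finite real combination of matrices. [folklore] -/
theorem coords_sum_smul {ι : Type*} (s : Finset ι) (c : ι → ℝ) (X : ι → Matrix (Fin 2) (Fin 2) ℂ) :
    ![((∑ a ∈ s, (c a : ℂ) • X a) 0 0).re, ((∑ a ∈ s, (c a : ℂ) • X a) 0 0).im,
        ((∑ a ∈ s, (c a : ℂ) • X a) 1 0).re, ((∑ a ∈ s, (c a : ℂ) • X a) 1 0).im] =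
      ∑ a ∈ s, c a • ![(X a 0 0).re, (X a 0 0).im, (X a 1 0).re, (X a 1 0).im] := by
  ext i
  fin_cases i <;> simp [Matrix.sum_apply, Matrix.smul_apply, Finset.sum_apply, Complex.re_sum, Complex.im_sum]

/-- ★★ **THE TWIST IS ORTHOGONAL ON `ℝ⁴`**: for `V, W ∈ SU(2)` there is a real `4×4` matrix `R` with `Rᵀ R = 1` such that
`v(V g W) = R *ᵥ v(g)` for every `g ∈ SU(2)` (columns `v(V E_a W)` over the unit quaternions `E_a`; orthonormal because `reTr` is conjugation
invariant), AND the twist defect is controlled by the two links: `‖R − 1‖_F² ≤ 8·(dist1(V)² + dist1(W)²)` (column `a` of `R − 1` is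
`v(VE_aW) − v(E_a)`, of squared length `dist1(V·E_aWE_a⁻¹)² ≤ (dist1 V + dist1 W)²`).  This is the bond transport `R_b` (`V := V_b`, `W := W_b⁻¹`) of
★w8-19936 g6's twisted Leung–Xin identity, with its `‖S_b − 1‖_F²` volume term bounded by the link deviations. [folklore] -/
theorem exists_orthogonal_twist (V W : Matrix.specialUnitaryGroup (Fin 2) ℂ) :
    ∃ R : Matrix (Fin 4) (Fin 4) ℝ, Rᵀ * R = 1 ∧
      (∑ i : Fin 4, ∑ a : Fin 4, (R i a - (1 : Matrix (Fin 4) (Fin 4) ℝ) i a) ^ 2 ≤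
          8 * (GaugeGroup.dist1 V ^ 2 + GaugeGroup.dist1 W ^ 2)) ∧
      ∀ g : Matrix.specialUnitaryGroup (Fin 2) ℂ,
      ![(((V * g * W : Matrix.specialUnitaryGroup (Fin 2) ℂ) : Matrix (Fin 2) (Fin 2) ℂ) 0 0).re,
          (((V * g * W : Matrix.specialUnitaryGroup (Fin 2) ℂ) : Matrix (Fin 2) (Fin 2) ℂ) 0 0).im,
          (((V * g * W : Matrix.specialUnitaryGroup (Fin 2) ℂ) : Matrix (Fin 2) (Fin 2) ℂ) 1 0).re,
          (((V * g * W : Matrix.specialUnitaryGroup (Fin 2) ℂ) : Matrix (Fin 2) (Fin 2) ℂ) 1 0).im] =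
        R *ᵥ ![((g : Matrix (Fin 2) (Fin 2) ℂ) 0 0).re, ((g : Matrix (Fin 2) (Fin 2) ℂ) 0 0).im,
          ((g : Matrix (Fin 2) (Fin 2) ℂ) 1 0).re, ((g : Matrix (Fin 2) (Fin 2) ℂ) 1 0).im] := by
  obtain ⟨hI, hJ, hK⟩ := quaternion_units_mem
  -- the four unit quaternions as `SU(2)` elements
  set E : Fin 4 → Matrix.specialUnitaryGroup (Fin 2) ℂ :=
    ![1, ⟨_, hI⟩, ⟨_, hJ⟩, ⟨_, hK⟩] with hE
  have hEmat : ∀ a : Fin 4, ((E a : Matrix.specialUnitaryGroup (Fin 2) ℂ) : Matrix (Fin 2) (Fin 2) ℂ) =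
      ![(1 : Matrix (Fin 2) (Fin 2) ℂ), !![Complex.I, 0; 0, -Complex.I], !![(0 : ℂ), -1; 1, 0], !![(0 : ℂ), Complex.I; Complex.I, 0]] a := by
    intro a; fin_cases a <;> rfl
  -- the matrix of the twist: column `a` = `v(V E_a W)`
  let R : Matrix (Fin 4) (Fin 4) ℝ := Matrix.of fun i a =>
    ![(((V * E a * W : Matrix.specialUnitaryGroup (Fin 2) ℂ) : Matrix (Fin 2) (Fin 2) ℂ) 0 0).re,
      (((V * E a * W : Matrix.specialUnitaryGroup (Fin 2) ℂ) : Matrix (Fin 2) (Fin 2) ℂ) 0 0).im,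
      (((V * E a * W : Matrix.specialUnitaryGroup (Fin 2) ℂ) : Matrix (Fin 2) (Fin 2) ℂ) 1 0).re,
      (((V * E a * W : Matrix.specialUnitaryGroup (Fin 2) ℂ) : Matrix (Fin 2) (Fin 2) ℂ) 1 0).im] i
  refine ⟨R, ?_, ?_, ?_⟩
  · -- orthonormal columns: `v(VE_aW)·v(VE_bW) = reTr((VE_aW)⁻¹(VE_bW)) = reTr(E_a⁻¹E_b) = δ_ab`
    ext a b
    rw [Matrix.mul_apply, Matrix.one_apply]
    have hcol : ∑ i : Fin 4, Rᵀ a i * R i b =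
        dotProduct
          ![(((V * E a * W : Matrix.specialUnitaryGroup (Fin 2) ℂ) : Matrix (Fin 2) (Fin 2) ℂ) 0 0).re,
            (((V * E a * W : Matrix.specialUnitaryGroup (Fin 2) ℂ) : Matrix (Fin 2) (Fin 2) ℂ) 0 0).im,
            (((V * E a * W : Matrix.specialUnitaryGroup (Fin 2) ℂ) : Matrix (Fin 2) (Fin 2) ℂ) 1 0).re,
            (((V * E a * W : Matrix.specialUnitaryGroup (Fin 2) ℂ) : Matrix (Fin 2) (Fin 2) ℂ) 1 0).im]
          ![(((V * E b * W : Matrix.specialUnitaryGroup (Fin 2) ℂ) : Matrix (Fin 2) (Fin 2) ℂ) 0 0).re,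
            (((V * E b * W : Matrix.specialUnitaryGroup (Fin 2) ℂ) : Matrix (Fin 2) (Fin 2) ℂ) 0 0).im,
            (((V * E b * W : Matrix.specialUnitaryGroup (Fin 2) ℂ) : Matrix (Fin 2) (Fin 2) ℂ) 1 0).re,
            (((V * E b * W : Matrix.specialUnitaryGroup (Fin 2) ℂ) : Matrix (Fin 2) (Fin 2) ℂ) 1 0).im] := by
      simp only [R, Matrix.transpose_apply, Matrix.of_apply, dotProduct, Fin.sum_univ_four]
    rw [hcol, ← reTr_inv_mul_eq_dot]
    have hgrp : (V * E a * W)⁻¹ * (V * E b * W) = W⁻¹ * ((E a)⁻¹ * E b) * W⁻¹⁻¹ := by group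
    rw [hgrp, GaugeGroup.reTr_conj, reTr_inv_mul_eq_dot, hEmat a, hEmat b]
    fin_cases a <;> fin_cases b <;> simp [dotProduct, Fin.sum_univ_four]
  · -- the defect: column `a` of `R − 1` is `v(VE_aW) − v(E_a)`, and `|v(X) − v(Y)|² = dist1(XY⁻¹)²`
    have hcolE : ∀ a i : Fin 4, (1 : Matrix (Fin 4) (Fin 4) ℝ) i a =
        ![(((E a : Matrix.specialUnitaryGroup (Fin 2) ℂ) : Matrix (Fin 2) (Fin 2) ℂ) 0 0).re,
          (((E a : Matrix.specialUnitaryGroup (Fin 2) ℂ) : Matrix (Fin 2) (Fin 2) ℂ) 0 0).im,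
          (((E a : Matrix.specialUnitaryGroup (Fin 2) ℂ) : Matrix (Fin 2) (Fin 2) ℂ) 1 0).re,
          (((E a : Matrix.specialUnitaryGroup (Fin 2) ℂ) : Matrix (Fin 2) (Fin 2) ℂ) 1 0).im] i := by
      intro a i
      rw [hEmat a]
      fin_cases a <;> fin_cases i <;> simp
    have hterm : ∀ a : Fin 4, ∑ i : Fin 4, (R i a - (1 : Matrix (Fin 4) (Fin 4) ℝ) i a) ^ 2 =
        GaugeGroup.dist1 ((V * E a * W) * (E a)⁻¹) ^ 2 := by
      intro a
      rw [dist1_mul_inv_sq_eq_dot_sub]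
      simp only [dotProduct, Fin.sum_univ_four, hcolE a, R, Matrix.of_apply]
      simp only [Pi.sub_apply]
      ring
    have hbound : ∀ a : Fin 4, GaugeGroup.dist1 ((V * E a * W) * (E a)⁻¹) ^ 2 ≤
        2 * (GaugeGroup.dist1 V ^ 2 + GaugeGroup.dist1 W ^ 2) := by
      intro a
      have h1 : (V * E a * W) * (E a)⁻¹ = V * (E a * W * (E a)⁻¹) := by group
      have h2 : GaugeGroup.dist1 ((V * E a * W) * (E a)⁻¹) ≤ GaugeGroup.dist1 V + GaugeGroup.dist1 W := by
        rw [h1]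
        exact (GaugeGroup.dist1_mul_le _ _).trans (by rw [GaugeGroup.dist1_conj])
      have h0 : 0 ≤ GaugeGroup.dist1 ((V * E a * W) * (E a)⁻¹) := GaugeGroup.dist1_nonneg _
      have hV0 : 0 ≤ GaugeGroup.dist1 V := GaugeGroup.dist1_nonneg _
      have hW0 : 0 ≤ GaugeGroup.dist1 W := GaugeGroup.dist1_nonneg _
      nlinarith [h2, h0, hV0, hW0, sq_nonneg (GaugeGroup.dist1 V - GaugeGroup.dist1 W)]
    calc ∑ i : Fin 4, ∑ a : Fin 4, (R i a - (1 : Matrix (Fin 4) (Fin 4) ℝ) i a) ^ 2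
        = ∑ a : Fin 4, ∑ i : Fin 4, (R i a - (1 : Matrix (Fin 4) (Fin 4) ℝ) i a) ^ 2 := Finset.sum_comm
      _ = ∑ a : Fin 4, GaugeGroup.dist1 ((V * E a * W) * (E a)⁻¹) ^ 2 := Finset.sum_congr rfl fun a _ => hterm a
      _ ≤ ∑ _a : Fin 4, 2 * (GaugeGroup.dist1 V ^ 2 + GaugeGroup.dist1 W ^ 2) := Finset.sum_le_sum fun a _ => hbound a
      _ = 8 * (GaugeGroup.dist1 V ^ 2 + GaugeGroup.dist1 W ^ 2) := by
          rw [Finset.sum_const, Finset.card_univ, Fintype.card_fin]; ring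
  · intro g
    -- `g = Σ_a p_a • E_a` as matrices, and `v` is linear
    have hg := su2_eq_quaternion_combination g
    set p : Fin 4 → ℝ := ![((g : Matrix (Fin 2) (Fin 2) ℂ) 0 0).re, ((g : Matrix (Fin 2) (Fin 2) ℂ) 0 0).im,
      ((g : Matrix (Fin 2) (Fin 2) ℂ) 1 0).re, ((g : Matrix (Fin 2) (Fin 2) ℂ) 1 0).im] with hp
    have hg' : ((g : Matrix.specialUnitaryGroup (Fin 2) ℂ) : Matrix (Fin 2) (Fin 2) ℂ) =
        ∑ a : Fin 4, (p a : ℂ) • ((E a : Matrix.specialUnitaryGroup (Fin 2) ℂ) : Matrix (Fin 2) (Fin 2) ℂ) := by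
      rw [Fin.sum_univ_four, hEmat 0, hEmat 1, hEmat 2, hEmat 3]
      simp only [hp, Matrix.cons_val_zero, Matrix.cons_val_one, Matrix.head_cons, Matrix.cons_val_two, Matrix.tail_cons,
        Matrix.cons_val_three]
      exact hg
    have hVgW : ((V * g * W : Matrix.specialUnitaryGroup (Fin 2) ℂ) : Matrix (Fin 2) (Fin 2) ℂ) =
        ∑ a : Fin 4, (p a : ℂ) • ((V * E a * W : Matrix.specialUnitaryGroup (Fin 2) ℂ) : Matrix (Fin 2) (Fin 2) ℂ) := by
      have : ((V * g * W : Matrix.specialUnitaryGroup (Fin 2) ℂ) : Matrix (Fin 2) (Fin 2) ℂ) =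
          (V : Matrix (Fin 2) (Fin 2) ℂ) * (g : Matrix (Fin 2) (Fin 2) ℂ) * (W : Matrix (Fin 2) (Fin 2) ℂ) := rfl
      rw [this, hg', Finset.mul_sum, Finset.sum_mul]
      refine Finset.sum_congr rfl fun a _ => ?_
      rw [Matrix.mul_smul, Matrix.smul_mul]
      rfl
    rw [hVgW, coords_sum_smul]
    ext i
    simp only [Finset.sum_apply, Pi.smul_apply, smul_eq_mul, Matrix.mulVec, dotProduct, R, Matrix.of_apply]
    refine Finset.sum_congr rfl fun a _ => ?_
    ring

end Summit.QuantumFields.YangMills.Theorems.PoincareLipschitzSU2SphereDictionary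

end
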